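import Summits.HodgeConjecture.HodgeConjecture.Theorems.Ring2WeilCoverageNormClassEq
import Summits.HodgeConjecture.HodgeConjecture.Theorems.Ring2WeilNormObstructionDescentCensus
import HarnessLib

/-!
# Weil-type family coverage — THEOREM S6 (product-window law), part G: `ℚ(√-7)` REACHED — a curve-carried `(3,3)` Weil-type sixfold on
# `W6.7.3 = (3, ℚ(√-7), [3])` (pub-hsemireg's R4, `ℚ(√-7)`, `a = 3`) from the rigid `PSL₂(7) × S₃`-curve `(0; 7a:2, 7a:2, 7a:3)` of genus 409

research route conditional on HC_CM; not a corollary; Q11.4-sentence-2 already refuted in dim ≥ 3.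

Ring 2, WEIL-TYPE FAMILY-COVERAGE CENSUS (`## b04`, block b04.13 P.S. 7, owner ring2-b04, gen 49); seventh part of
`Ring2WeilCoverageProductWindow` (same imports as part A).  `K = ℚ(√-7)` through a 3-dimensional character `λ` of `PSL₂(7)` (line-fixing
subgroup `H₁ = C₃`), `G₂ = S₃` (`n = 3`, inert in `ℚ(√-7)`); THEOREM S6 with the `3`-adic bit of the defect-zero block (`e = 1`, as for
`F₂₁`, census b04.13 P.S. 5) predicts `[a_B] = [3]^{r₁ + m}`, here `r₁ = 3`, `m = 6`: class `[3]`, `T = {3,7}` — NON-split.  The engine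
(`census-g49/bundle3/cosetwin.py`, coset cover with 168 sheets of genus 65, 524 s) returns `det_K H = -23/677376 = -23/(2⁹·3³·7²)`,
`T = {3,7}`: **row `W6.7.3`**, the `ℚ(√-7)` TARGET row that no census window had reached (b04.12 COROLLARY F, b02.20.4, b04.13 (D)/P.S. 6:
negatives for `PSL₂(7)`/`F₂₁` alone, `SL₂(𝔽₇)`, `F₂₁ × S₃` sixfolds, `F₂₁ × F₂₀`, `PSL₂(7) × F₂₀`).  The curve is rigid (Belyi): ONE
`ℚ̄`-point of the 9-dimensional component; CM-ness not claimed; nothing about Hodge classes.  Also: the Galois-cover engine's value for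
ring2-b06's invited `C₃ × A₅` R2 datum (kit j197757, genus 88; the coset engine's class of part F re-met).
No `def`, no named fact, no `sorry`; `HC_CM` used nowhere.  References: [cite: vanGeemen1994HodgeAV, (5.4.1), Lemma 5.2].
-/

set_option linter.dupNamespace false

open Literature.AlgebraicGeometry.Motives
open Literature.AlgebraicGeometry.VanGeemen1994
open Summit.HodgeConjecture.HodgeConjecture.Ring2.Hypotheses

namespace Summit.HodgeConjecture.HodgeConjecture.Ring2.WeilCoverage

/-- `PSL₂(7) × S₃`-cover `(0; 7a:2,7a:2,7a:3)` (genus 409, Hurwitz dimension 0; engine `cosetwin.py` on the coset cover `C̃/(C₃ × C₂)`, 168 sheets, genus 65, its own polarisation, exact): the HIDDEN FACTOR `B = V^{H₁×Stab(0)}` of the `(λ⊗ρ)`-piece (census row of `P`: `None`) — an abelian SIXFOLD with `(3,3)` `ℚ(√-7)`-action, WEIL TYPE — has literal `det H|_B = -23/677376`, `a = 23/677376`, `T(a) = [3, 7]`: row `W6.7.3` (NON-split); `r₁ = dim_K H¹(C̃/G₂)_λ = 3`.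
research route conditional on HC_CM; not a corollary; Q11.4-sentence-2 already refuted in dim ≥ 3. [cite: vanGeemen1994HodgeAV, (5.4.1)] -/
theorem pwL27cS3_7a2_7a2_7a3_q0_g409_mk_detH_ne_split :
    (QuotientGroup.mk (Units.mk0 (((-23 : ℚ) / 677376)) (by norm_num)) : weilNormResidueGroup 7) ≠
      splitDiscriminantClass 3 7 := by
  have e : Units.mk0 (((-23 : ℚ) / 677376)) (by norm_num) = -(Units.mk0 ((23 : ℚ) / 677376) (by norm_num)) := Units.ext (by norm_num)
  rw [Ne, e, mk_neg_eq_splitDiscriminantClass_iff_of_odd (n := 3) (by decide)]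
  have h := mul_not_mem_normUnitsSubgroup (mem_normUnitsSubgroup_of_sq_add_mul_sq (d := 7) (a := ((23 : ℚ) / 2032128)) (by norm_num) ((-1 : ℚ) / 1344) ((5 : ℚ) / 4032) (by norm_num))
    Summit.HodgeConjecture.Ring2WeilNormDescent.three_not_mem_norm_seven
  rw [mk0_mul_mk0] at h
  norm_num at h
  exact h

/-- The same datum, CELL IDENTIFICATION: `[det H|_B] = [-3]` in `ℚˣ/Nm(ℚ(√-7)ˣ)` — the census ROW KEY of `W6.7.3` (`a·3 = ((23 : ℚ) / 225792) = (((-1 : ℚ) / 448))² + 7·(((5 : ℚ) / 1344))²`).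
research route conditional on HC_CM; not a corollary; Q11.4-sentence-2 already refuted in dim ≥ 3. [cite: vanGeemen1994HodgeAV, Lemma 5.2 (3)] -/
theorem pwL27cS3_7a2_7a2_7a3_q0_g409_mk_detH_eq_key :
    (QuotientGroup.mk (Units.mk0 (-(((23 : ℚ) / 677376))) (neg_ne_zero.2 (by norm_num))) : weilNormResidueGroup 7) =
      QuotientGroup.mk (Units.mk0 (-(3 : ℚ)) (neg_ne_zero.2 (by norm_num))) :=
  mk_neg_eq_mk_neg_of_mul_mem (by norm_num) (by norm_num)
    (mem_normUnitsSubgroup_of_sq_add_mul_sq _ ((-1 : ℚ) / 448) ((5 : ℚ) / 1344) (by norm_num))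

/-- `C₃ × A₅` (on 5 points)-cover `(0; c0:5A,c1:3,c1:3,c1:22)` (genus 88, Hurwitz dimension 1; engine `prodwin.py`, exact): the HIDDEN FACTOR `B = V^{H₁×Stab(0)}` of the `(λ⊗ρ)`-piece `P ~ B^{4}` (census row of `P`: `W24.3.1`) — an abelian SIXFOLD with `(3,3)` `ℚ(√-3)`-action, WEIL TYPE — has literal `det H|_B = -65536/8505`, `a = 65536/8505`, `T(a) = [3, 5]`: row `W6.3.5` (NON-split); `r₁ = dim_K H¹(C̃/G₂)_λ = 1`. THEOREM S6 (product-window law, census b04.13 (A)) predicts `T(a_B) = [3, 5]` from `r₁ = 1`, `r_H = 7` — CONFIRMED.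
research route conditional on HC_CM; not a corollary; Q11.4-sentence-2 already refuted in dim ≥ 3. [cite: vanGeemen1994HodgeAV, (5.4.1)] -/
theorem pwC3A5_c05A_c13_c13_c122_q0_g88_galois_mk_detH_ne_split :
    (QuotientGroup.mk (Units.mk0 (((-65536 : ℚ) / 8505)) (by norm_num)) : weilNormResidueGroup 3) ≠
      splitDiscriminantClass 3 3 := by
  have e : Units.mk0 (((-65536 : ℚ) / 8505)) (by norm_num) = -(Units.mk0 ((65536 : ℚ) / 8505) (by norm_num)) := Units.ext (by norm_num)
  rw [Ne, e, mk_neg_eq_splitDiscriminantClass_iff_of_odd (n := 3) (by decide)]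
  have h := mul_not_mem_normUnitsSubgroup (mem_normUnitsSubgroup_of_sq_add_mul_sq (d := 3) (a := ((65536 : ℚ) / 42525)) (by norm_num) ((-128 : ℚ) / 315) ((128 : ℚ) / 189) (by norm_num))
    Summit.HodgeConjecture.Ring2WeilNormDescent.five_not_mem_norm_three
  rw [mk0_mul_mk0] at h
  norm_num at h
  exact h

/-- The same datum, CELL IDENTIFICATION: `[det H|_B] = [-5]` in `ℚˣ/Nm(ℚ(√-3)ˣ)` — the census ROW KEY of `W6.3.5` (`a·5 = ((65536 : ℚ) / 1701) = (((-128 : ℚ) / 63))² + 3·(((640 : ℚ) / 189))²`).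
research route conditional on HC_CM; not a corollary; Q11.4-sentence-2 already refuted in dim ≥ 3. [cite: vanGeemen1994HodgeAV, Lemma 5.2 (3)] -/
theorem pwC3A5_c05A_c13_c13_c122_q0_g88_galois_mk_detH_eq_key :
    (QuotientGroup.mk (Units.mk0 (-(((65536 : ℚ) / 8505))) (neg_ne_zero.2 (by norm_num))) : weilNormResidueGroup 3) =
      QuotientGroup.mk (Units.mk0 (-(5 : ℚ)) (neg_ne_zero.2 (by norm_num))) :=
  mk_neg_eq_mk_neg_of_mul_mem (by norm_num) (by norm_num)
    (mem_normUnitsSubgroup_of_sq_add_mul_sq _ ((-128 : ℚ) / 63) ((640 : ℚ) / 189) (by norm_num))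

end Summit.HodgeConjecture.HodgeConjecture.Ring2.WeilCoverage
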